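import Summits.Ventures.PercRepro.RankLevelSetRuleQCell

/-!
# PercRepro — RULE Q AT THE TIGHT LAYER: THE CELL INEQUALITIES `RhatCell q k` BY KERNEL EVALUATION (RankLevelSetRuleQCellEvalQ8B; night-1, gen 14)

Each theorem `rhatCell_q_k : RhatCell q k` (`∀ m ≤ q, Φ(q+k, q) ≤ R̂(q, k, m)`, RankLevelSetRuleQCell) is discharged by
`interval_cases m` and `norm_num` on the unfolded binomial sums (`Nat.choose` by its recursion; the
`Finset.Ioo`-sums as `Finset.range`-sums via `sum_Ioo_nat`). No `native_decide`, no `decide` on the rationals. With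
`hallUp_of_ncard_eq_of_rhatCell` each cell gives the UP form of C-044 at the tight layer `#E = (q+k) + q` of the cell
`(q+k, q)` for every finite matroid; the DOWN form is `hallDown_of_ncard_eq`. Cells: (8,8).
Axioms: standard.
-/

namespace PercRepro

open Finset

/-- `Φ(16, 8) ≤ R̂(8, 8, 0)` (the cell `(16, 8)` at `#P = 0`), by kernel evaluation. -/
theorem rhatCell_8_8_0 : phiK (8 + 8) 8 ≤ rhat 8 8 0 := by
  simp only [rhat, phiK, mhat, sum_Ioo_nat]
  norm_num [Finset.sum_range_succ, Nat.choose, Nat.min_def]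

/-- `Φ(16, 8) ≤ R̂(8, 8, 1)` (the cell `(16, 8)` at `#P = 1`), by kernel evaluation. -/
theorem rhatCell_8_8_1 : phiK (8 + 8) 8 ≤ rhat 8 8 1 := by
  simp only [rhat, phiK, mhat, sum_Ioo_nat]
  norm_num [Finset.sum_range_succ, Nat.choose, Nat.min_def]

/-- `Φ(16, 8) ≤ R̂(8, 8, 2)` (the cell `(16, 8)` at `#P = 2`), by kernel evaluation. -/
theorem rhatCell_8_8_2 : phiK (8 + 8) 8 ≤ rhat 8 8 2 := by
  simp only [rhat, phiK, mhat, sum_Ioo_nat]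
  norm_num [Finset.sum_range_succ, Nat.choose, Nat.min_def]

/-- `Φ(16, 8) ≤ R̂(8, 8, 3)` (the cell `(16, 8)` at `#P = 3`), by kernel evaluation. -/
theorem rhatCell_8_8_3 : phiK (8 + 8) 8 ≤ rhat 8 8 3 := by
  simp only [rhat, phiK, mhat, sum_Ioo_nat]
  norm_num [Finset.sum_range_succ, Nat.choose, Nat.min_def]

/-- `Φ(16, 8) ≤ R̂(8, 8, 4)` (the cell `(16, 8)` at `#P = 4`), by kernel evaluation. -/
theorem rhatCell_8_8_4 : phiK (8 + 8) 8 ≤ rhat 8 8 4 := by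
  simp only [rhat, phiK, mhat, sum_Ioo_nat]
  norm_num [Finset.sum_range_succ, Nat.choose, Nat.min_def]

/-- `Φ(16, 8) ≤ R̂(8, 8, 5)` (the cell `(16, 8)` at `#P = 5`), by kernel evaluation. -/
theorem rhatCell_8_8_5 : phiK (8 + 8) 8 ≤ rhat 8 8 5 := by
  simp only [rhat, phiK, mhat, sum_Ioo_nat]
  norm_num [Finset.sum_range_succ, Nat.choose, Nat.min_def]

/-- `Φ(16, 8) ≤ R̂(8, 8, 6)` (the cell `(16, 8)` at `#P = 6`), by kernel evaluation. -/
theorem rhatCell_8_8_6 : phiK (8 + 8) 8 ≤ rhat 8 8 6 := by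
  simp only [rhat, phiK, mhat, sum_Ioo_nat]
  norm_num [Finset.sum_range_succ, Nat.choose, Nat.min_def]

/-- `Φ(16, 8) ≤ R̂(8, 8, 7)` (the cell `(16, 8)` at `#P = 7`), by kernel evaluation. -/
theorem rhatCell_8_8_7 : phiK (8 + 8) 8 ≤ rhat 8 8 7 := by
  simp only [rhat, phiK, mhat, sum_Ioo_nat]
  norm_num [Finset.sum_range_succ, Nat.choose, Nat.min_def]

/-- `Φ(16, 8) ≤ R̂(8, 8, 8)` (the cell `(16, 8)` at `#P = 8`), by kernel evaluation. -/
theorem rhatCell_8_8_8 : phiK (8 + 8) 8 ≤ rhat 8 8 8 := by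
  simp only [rhat, phiK, mhat, sum_Ioo_nat]
  norm_num [Finset.sum_range_succ, Nat.choose, Nat.min_def]

/-- The cell `(16, 8)` (`q = 8`, `k = 8`): `Φ(16, 8) ≤ R̂(8, 8, m)` for every `m ≤ 8`. -/
theorem rhatCell_8_8 : RhatCell 8 8 := by
  intro m hm
  interval_cases m
  · exact rhatCell_8_8_0
  · exact rhatCell_8_8_1
  · exact rhatCell_8_8_2
  · exact rhatCell_8_8_3
  · exact rhatCell_8_8_4
  · exact rhatCell_8_8_5
  · exact rhatCell_8_8_6
  · exact rhatCell_8_8_7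
  · exact rhatCell_8_8_8

end PercRepro
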